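import Literature.Probability.Entropy.EntropyTransportIntegrable
import Summits.QuantumFields.YangMills.Theorems.SourcedPressureJensenSourcedPressureIncrementGaussSqExpMoment
import Summits.QuantumFields.YangMills.Theorems.EntropyBudgetEquipartitionCovTransferPerturb
import HarnessLib

/-!
# Route `EntropyBudgetEquipartition`, crux `EntropyBudgetTransfer` (stmt-QuantumFields-22401) — helper «KT2/KT3»:
# ENTROPIC PRICING OF COHERENT BOUNDARY MODES (the typical-boundary budget, abstract core)

HONEST LABEL: bookkeeping toward a RECORD-label rung (R2ξ-G, the all-`G` leaf `WeakCouplingRates.XiPow`, an UPPER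
bound on the lattice gap); nothing here bears on the Yang–Mills mass gap, and nothing in this file is specific to gauge
theories — it is probability (relative entropy, a χ² moment, Cauchy–Schwarz).

## Where this sits

The crux is the TWO-SIDED free-gluon law `|β²·Cov_{β,L}(c₀, c_n) − σ·C(n)²| ≤ C β^{−κ'}`.  The sibling route
`ColdBoxAllGroups` (crux `BulkAllGroups`, stmt-QuantumFields-22255) reaches the torus state through the DLR law of total
covariance over a box of side `H = ⌈β^θ⌉` around the two plaquettes,
`Cov_μ(c_p, c_q) = E_μ[Cov_ω(c_p, c_q)] + Cov_μ(E_ω c_p, E_ω c_q)` (`ω` = the exterior datum), and its one-scale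
interfaces are ALREADY two-sided: `KernelCovExpansionG` gives `β²Cov_ω = (D/2)C_D² + 2β(Σ_c F̄_c(p)F̄_c(q))C_D ± β^{−θ/2}` and
`KernelMeanExpansionG` gives `βE_ω[c_p] = (D/2)V_D(p) + βΣ_c F̄_c(p)² ± β^{−θ}` uniformly over crude-good data, `F̄_c` the
harmonic background extending the datum (`Theorems/ColdBoxAllGroupsDefs.lean`).  A FLOOR only needs the difference of the two
conditional means (`Cov(h,k) ≥ −¼E(h−k)²`), which is why `BulkAllGroups` is reachable; the TWO-SIDED law needs the «wall term»
`Cov_μ(E_ω c_p, E_ω c_q)` itself to be small, i.e. (part 4 of this line's «KT3 → KT», `CovTransfer.abs_cov_mixture_sub_le`)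
the `μ`-fluctuation `E_μ[(βE_ω c_p − (D/2)V_D)²]` of the conditional mean — the TYPICAL size of the coherent background mode
`βΣ_c F̄_c(p)²` under the Yang–Mills state.  Crude-good data allow `βF̄² ≲ β^{2δ}`; typical data should give `≲ H^{−4}`.

## What this file proves (the entropy line's lever for exactly that term)

Under the free field `γ` the mode `X_c = √β F̄_c(p)` is a centred Gaussian whose variance is the Dirichlet-vs-free gap
`v = V_free(p) − V_D(p) ≤ K/H⁴` (tree `WeakCouplingRates.exists_boxDirProjKernel_sub_curl_bound`).  Relative entropy prices
such a mode: by Donsker–Varadhan and the χ² moment `E_γ e^{X²/(4v)} ≤ e^{1/2}`,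

* `integral_sq_le_of_klDiv` — **`E_ν[X²] ≤ 4v·(KL(ν ‖ γ) + ½)`** for every probability `ν` of finite relative entropy w.r.t. a
  law `γ` under which `E_γ exp(X²/(4v)) ≤ e^{1/2}`;
* `integral_exp_mul_sq_gaussianReal_var`, `integral_exp_sq_div_le_of_map_eq_gaussianReal` — the χ² moment generating function
  at a general variance, `∫ e^{t x²} dN(0,s) = (1 − 2ts)^{−1/2}`, and the hypothesis above for a mode with `γ`-law `N(0,s)`, `s ≤ v`;
* `integral_sq_le_of_klDiv_of_gaussian` — the Gaussian instance `E_ν[X²] ≤ 4v(KL + ½)`;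
* `integral_sum_sq_le_of_klDiv` — `D` modes: `E_ν[Σ_c X_c²] ≤ 4(Σ_c v_c)(KL + ½)` (pricing is linear; no joint structure of the
  modes is needed);
* `integral_sq_sub_le_of_decomp`, `integral_sq_sub_le_of_pricing` — from the mean expansion `b = b₀ + q + r`, `0 ≤ q ≤ M`,
  `|r| ≤ ε` (`q = Σ_c X_c²` the priced mode, `M` its crude-good ceiling, `ε` the expansion error):
  `E_ν[(b − b₀)²] ≤ 2M·E_ν[q] + 2ε² ≤ 8M(Σ_c v_c)(KL + ½) + 2ε²`;
* `abs_wallTerm_le_of_pricing` — hence the wall term of the law of total covariance is at most that same quantity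
  (`CovTransfer.abs_cov_mixture_sub_le` with both conditional means priced).

## The bookkeeping this enables (numbers, for the planner; not formalised here)

With `H = β^θ`, `v_tot ≤ DK/H⁴`, `M = C β^{2δ}` (crude-good ceiling), `ε = β^{−θ}`, and a block relative-entropy budget
`KL ≤ E_B` for the law of the (gauge-fixed, charted) datum against its Gaussian counterpart, the wall term is
`≤ 8CDK·β^{2δ}·E_B/H⁴ + O(β^{2δ−4θ}) + 2β^{−2θ}`.  A budget `E_B ≤ ℓ⁴β^{−κ} + c ℓ³ log β` (global free-energy RATE K1 = crux
`FreeEnergyRate`, PROVED, localised to blocks of side `ℓ ≍ H` with block-product Gaussian reference; the seams cost `log β`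
per crossing link, not `β`) gives `≲ β^{2δ−κ} + β^{2δ−θ} log β → 0` as soon as `2δ < min(κ, θ)` — the seam entropy `ℓ³ log β`
is AFFORDABLE because the priced mode has variance `H^{−4}`, not `O(1)`.  So: two-sided law at one separation ⇐ the sibling's
two-sided one-scale interfaces (N2-G) + a block entropy budget `o(β^{−2δ}H⁴)` + this file + the landed Gaussian kernel facts;
the floor (`BulkAllGroups`) never needs the entropy input.  What remains genuinely open on this line is that block budget (KT2).

References: Donsker–Varadhan / Gibbs variational formula [cite: BoucheronLugosiMassart2013, Cor. 4.14]; the χ² moment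
generating function [folklore]; law of total covariance [folklore].  Written by width seat 2/3 (gen 3) of line
`ym-line-ebe-p1` as `--supports stmt-QuantumFields-22401`.
-/

set_option autoImplicit false

noncomputable section

open MeasureTheory ProbabilityTheory InformationTheory Real
open scoped NNReal

namespace Summit.QuantumFields.YangMills.Theorems.EntropyBudgetEquipartition.ModePricing

/-! ### §1 Pricing one quadratic mode by relative entropy -/

section Pricing

variable {Ω : Type*} [MeasurableSpace Ω] {γ ν : Measure Ω} [IsProbabilityMeasure γ] [IsProbabilityMeasure ν]

/-- **Entropic pricing of a quadratic mode.**  If under the reference law `γ` the mode `X` has the χ²-type exponential moment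
`E_γ exp(X²/(4v)) ≤ e^{1/2}` (`v > 0`; e.g. `X ∼ N(0, s)` with `s ≤ v`), then for every probability measure `ν` with
`KL(ν ‖ γ) < ∞` under which `X²` is integrable, `E_ν[X²] ≤ 4v·(KL(ν ‖ γ) + ½)`: a mode of reference variance `v` cannot be
excited to mean square `≫ v·KL` without paying relative entropy.  (Donsker–Varadhan at `g = X²/(4v)`.)
[cite: BoucheronLugosiMassart2013, Cor. 4.14] -/
theorem integral_sq_le_of_klDiv (hfin : klDiv ν γ ≠ ⊤) {X : Ω → ℝ} {v : ℝ} (hv : 0 < v)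
    (hXν : Integrable (fun ω => X ω ^ 2) ν)
    (hexp : Integrable (fun ω => Real.exp (X ω ^ 2 / (4 * v))) γ)
    (hmom : ∫ ω, Real.exp (X ω ^ 2 / (4 * v)) ∂γ ≤ Real.exp (1 / 2)) :
    ∫ ω, X ω ^ 2 ∂ν ≤ 4 * v * ((klDiv ν γ).toReal + 1 / 2) := by
  have h4v : 0 < 4 * v := by positivity
  have hg : Integrable (fun ω => X ω ^ 2 / (4 * v)) ν := hXν.div_const _
  have dv := Literature.Probability.Entropy.integral_le_toReal_klDiv_add_log_of_integrable (μ := γ) hfin hg hexp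
  have hpos : 0 < ∫ ω, Real.exp (X ω ^ 2 / (4 * v)) ∂γ := integral_exp_pos hexp
  have hlog : Real.log (∫ ω, Real.exp (X ω ^ 2 / (4 * v)) ∂γ) ≤ 1 / 2 := by
    calc Real.log (∫ ω, Real.exp (X ω ^ 2 / (4 * v)) ∂γ)
        ≤ Real.log (Real.exp (1 / 2)) := Real.log_le_log hpos hmom
      _ = 1 / 2 := Real.log_exp _
  have h1 : ∫ ω, X ω ^ 2 / (4 * v) ∂ν = (∫ ω, X ω ^ 2 ∂ν) / (4 * v) := integral_div _ _
  rw [h1] at dv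
  have h2 : (∫ ω, X ω ^ 2 ∂ν) / (4 * v) ≤ (klDiv ν γ).toReal + 1 / 2 := by linarith
  rw [div_le_iff₀ h4v] at h2
  linarith

/-- **Pricing is linear: finitely many modes.**  If each mode `X_c` (`c ∈ ι`) satisfies the χ²-moment hypothesis of
`integral_sq_le_of_klDiv` with variance proxy `v_c`, then `E_ν[Σ_c X_c²] ≤ 4(Σ_c v_c)(KL(ν ‖ γ) + ½)` — no joint (in)dependence
structure of the modes under `γ` is used. [cite: BoucheronLugosiMassart2013, Cor. 4.14] -/
theorem integral_sum_sq_le_of_klDiv {ι : Type*} [Fintype ι] (hfin : klDiv ν γ ≠ ⊤) {X : ι → Ω → ℝ} {v : ι → ℝ}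
    (hv : ∀ c, 0 < v c) (hXν : ∀ c, Integrable (fun ω => X c ω ^ 2) ν)
    (hexp : ∀ c, Integrable (fun ω => Real.exp (X c ω ^ 2 / (4 * v c))) γ)
    (hmom : ∀ c, ∫ ω, Real.exp (X c ω ^ 2 / (4 * v c)) ∂γ ≤ Real.exp (1 / 2)) :
    ∫ ω, ∑ c, X c ω ^ 2 ∂ν ≤ 4 * (∑ c, v c) * ((klDiv ν γ).toReal + 1 / 2) := by
  rw [integral_finsetSum _ fun c _ => hXν c, Finset.mul_sum, Finset.sum_mul]
  exact Finset.sum_le_sum fun c _ => integral_sq_le_of_klDiv hfin (hv c) (hXν c) (hexp c) (hmom c)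

end Pricing

/-! ### §2 The χ² moment of a centred Gaussian mode (general variance) -/

section Gaussian

/-- Density computation: `φ_{0,s}(x) · e^{t x²} = (2πs)^{-1/2} e^{−(1/(2s) − t) x²}` (`s ≠ 0`). [folklore] -/
theorem gaussianPDFReal_mul_exp_mul_sq_var {s : ℝ≥0} (hs : s ≠ 0) (t x : ℝ) :
    gaussianPDFReal 0 s x * Real.exp (t * x ^ 2) =
      (√(2 * π * s))⁻¹ * Real.exp (-(1 / (2 * (s : ℝ)) - t) * x ^ 2) := by
  rw [gaussianPDFReal_def]
  simp only [sub_zero]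
  rw [mul_assoc, ← Real.exp_add]
  congr 2
  have hs' : (s : ℝ) ≠ 0 := NNReal.coe_ne_zero.mpr hs
  field_simp
  ring

/-- **χ² moment generating function at variance `s`.**  For `t·s < 1/2`: `e^{t x²}` is integrable for `N(0,s)` and
`∫ e^{t x²} dN(0,s) = √(1/(1 − 2ts))` (for `s = 0` both sides are `1`). [folklore] -/
theorem integral_exp_mul_sq_gaussianReal_var {s : ℝ≥0} {t : ℝ} (hts : t * s < 1 / 2) :
    Integrable (fun x : ℝ => Real.exp (t * x ^ 2)) (gaussianReal 0 s) ∧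
      ∫ x, Real.exp (t * x ^ 2) ∂gaussianReal 0 s = √(1 / (1 - 2 * t * s)) := by
  by_cases hs : s = 0
  · subst hs
    simp only [gaussianReal_zero_var, NNReal.coe_zero, mul_zero, sub_zero, div_one, Real.sqrt_one]
    refine ⟨integrable_dirac (by simp), ?_⟩
    rw [integral_dirac]
    simp
  have hs' : (0 : ℝ) < s := lt_of_le_of_ne s.2 (fun h => hs (NNReal.coe_eq_zero.mp h.symm))
  have h2s : 0 < 2 * (s : ℝ) := by linarith
  have hb : 0 < 1 / (2 * (s : ℝ)) - t := by
    rw [sub_pos, lt_div_iff₀ h2s]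
    linarith
  constructor
  · rw [gaussianReal_of_var_ne_zero 0 hs,
      integrable_withDensity_iff_integrable_smul' (measurable_gaussianPDF 0 s)
        (ae_of_all _ fun _ => gaussianPDF_lt_top)]
    have h : (fun x : ℝ => (gaussianPDF 0 s x).toReal • Real.exp (t * x ^ 2)) =
        fun x => (√(2 * π * s))⁻¹ * Real.exp (-(1 / (2 * (s : ℝ)) - t) * x ^ 2) := by
      funext x
      rw [toReal_gaussianPDF, smul_eq_mul, gaussianPDFReal_mul_exp_mul_sq_var hs]
    rw [h]
    exact (integrable_exp_neg_mul_sq hb).const_mul _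
  · rw [integral_gaussianReal_eq_integral_smul hs]
    simp_rw [smul_eq_mul, gaussianPDFReal_mul_exp_mul_sq_var hs, integral_const_mul, integral_gaussian]
    have hπ : 0 < π := Real.pi_pos
    rw [← Real.sqrt_inv, ← Real.sqrt_mul (by positivity)]
    congr 1
    field_simp

/-- The bound form: `∫ e^{t x²} dN(0,s) ≤ e^{2ts}` for `0 ≤ t`, `t·s ≤ 1/4`. [folklore] -/
theorem integral_exp_mul_sq_gaussianReal_var_le {s : ℝ≥0} {t : ℝ} (ht : 0 ≤ t) (hts : t * s ≤ 1 / 4) :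
    ∫ x, Real.exp (t * x ^ 2) ∂gaussianReal 0 s ≤ Real.exp (2 * (t * s)) := by
  rw [(integral_exp_mul_sq_gaussianReal_var (by linarith)).2, show 2 * t * (s : ℝ) = 2 * (t * s) by ring]
  exact Summit.QuantumFields.YangMills.Cruxes.SourcedPressureIncrement.Birth.sqrt_one_div_one_sub_two_mul_le_exp
    (mul_nonneg ht s.2) hts

variable {Ω : Type*} [MeasurableSpace Ω] {γ : Measure Ω}

/-- **The χ²-moment hypothesis for a Gaussian mode.**  If the `γ`-law of `X` is `N(0,s)` with `s ≤ v`, `0 < v`, then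
`exp(X²/(4v))` is `γ`-integrable and `E_γ exp(X²/(4v)) ≤ e^{1/2}`. [folklore] -/
theorem integral_exp_sq_div_le_of_map_eq_gaussianReal {X : Ω → ℝ} (hX : AEMeasurable X γ) {s : ℝ≥0} {v : ℝ}
    (hv : 0 < v) (hlaw : γ.map X = gaussianReal 0 s) (hsv : (s : ℝ) ≤ v) :
    Integrable (fun ω => Real.exp (X ω ^ 2 / (4 * v))) γ ∧
      ∫ ω, Real.exp (X ω ^ 2 / (4 * v)) ∂γ ≤ Real.exp (1 / 2) := by
  set t : ℝ := 1 / (4 * v) with ht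
  have ht0 : 0 ≤ t := by positivity
  have hts : t * s ≤ 1 / 4 := by
    rw [ht, one_div_mul_eq_div, div_le_iff₀ (by positivity)]
    linarith
  have hcomp : ∀ ω, Real.exp (X ω ^ 2 / (4 * v)) = Real.exp (t * X ω ^ 2) := by
    intro ω; congr 1; rw [ht]; ring
  have hmeas : AEStronglyMeasurable (fun x : ℝ => Real.exp (t * x ^ 2)) (γ.map X) :=
    (by fun_prop : Measurable fun x : ℝ => Real.exp (t * x ^ 2)).aestronglyMeasurable
  have hint : Integrable (fun x : ℝ => Real.exp (t * x ^ 2)) (γ.map X) := by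
    rw [hlaw]; exact (integral_exp_mul_sq_gaussianReal_var (by linarith)).1
  refine ⟨?_, ?_⟩
  · have hi : Integrable ((fun x : ℝ => Real.exp (t * x ^ 2)) ∘ X) γ := (integrable_map_measure hmeas hX).1 hint
    exact hi.congr (Filter.Eventually.of_forall fun ω => (hcomp ω).symm)
  · have e : ∫ ω, Real.exp (X ω ^ 2 / (4 * v)) ∂γ = ∫ x, Real.exp (t * x ^ 2) ∂(γ.map X) := by
      rw [integral_map hX hmeas]
      exact integral_congr_ae (Filter.Eventually.of_forall fun ω => hcomp ω)
    rw [e, hlaw]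
    calc ∫ x, Real.exp (t * x ^ 2) ∂gaussianReal 0 s ≤ Real.exp (2 * (t * s)) :=
          integral_exp_mul_sq_gaussianReal_var_le ht0 hts
      _ ≤ Real.exp (1 / 2) := Real.exp_le_exp.2 (by linarith)

variable {ν : Measure Ω} [IsProbabilityMeasure γ] [IsProbabilityMeasure ν]

/-- **Entropic pricing of a Gaussian mode.**  If the `γ`-law of `X` is `N(0,s)`, `s ≤ v`, `0 < v`, then every probability
measure `ν` with `KL(ν ‖ γ) < ∞` under which `X²` is integrable has `E_ν[X²] ≤ 4v(KL(ν ‖ γ) + ½)`.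
[cite: BoucheronLugosiMassart2013, Cor. 4.14] -/
theorem integral_sq_le_of_klDiv_of_gaussian (hfin : klDiv ν γ ≠ ⊤) {X : Ω → ℝ} (hX : AEMeasurable X γ) {s : ℝ≥0}
    {v : ℝ} (hv : 0 < v) (hlaw : γ.map X = gaussianReal 0 s) (hsv : (s : ℝ) ≤ v)
    (hXν : Integrable (fun ω => X ω ^ 2) ν) :
    ∫ ω, X ω ^ 2 ∂ν ≤ 4 * v * ((klDiv ν γ).toReal + 1 / 2) := by
  obtain ⟨hexp, hmom⟩ := integral_exp_sq_div_le_of_map_eq_gaussianReal hX hv hlaw hsv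
  exact integral_sq_le_of_klDiv hfin hv hXν hexp hmom

end Gaussian

/-! ### §3 From priced modes to the wall term of the law of total covariance -/

section WallTerm

variable {S : Type*} [MeasurableSpace S] {μ : Measure S} [IsProbabilityMeasure μ]

/-- **Fluctuation of an expanded conditional mean.**  If `b = b₀ + q + r` pointwise with `0 ≤ q ≤ M` and `|r| ≤ ε` (`q` the
coherent-mode term of a one-scale mean expansion, `M` its ceiling on the data considered, `ε` the expansion error), then
`E_μ[(b − b₀)²] ≤ 2M·E_μ[q] + 2ε²` — the mean square of the conditional mean about its flat value is controlled by the FIRST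
moment of the mode term. [folklore] -/
theorem integral_sq_sub_le_of_decomp {b q r : S → ℝ} {b₀ M ε : ℝ}
    (hb : ∀ s, b s = b₀ + q s + r s) (hq0 : ∀ s, 0 ≤ q s) (hqM : ∀ s, q s ≤ M) (hr : ∀ s, |r s| ≤ ε)
    (hq : Integrable q μ) :
    ∫ s, (b s - b₀) ^ 2 ∂μ ≤ 2 * M * ∫ s, q s ∂μ + 2 * ε ^ 2 := by
  have hpt : ∀ s, (b s - b₀) ^ 2 ≤ 2 * M * q s + 2 * ε ^ 2 := by
    intro s
    have e : b s - b₀ = q s + r s := by rw [hb s]; ring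
    rw [e]
    have h1 : (q s + r s) ^ 2 ≤ 2 * q s ^ 2 + 2 * r s ^ 2 := by nlinarith [sq_nonneg (q s - r s)]
    have h2 : q s ^ 2 ≤ M * q s := by nlinarith [hq0 s, hqM s]
    have h3 : r s ^ 2 ≤ ε ^ 2 := by
      have := hr s
      have hε : 0 ≤ ε := (abs_nonneg _).trans this
      nlinarith [abs_le.mp this, sq_abs (r s)]
    linarith
  have hrhs : Integrable (fun s => 2 * M * q s + 2 * ε ^ 2) μ := (hq.const_mul _).add (integrable_const _)
  calc ∫ s, (b s - b₀) ^ 2 ∂μ ≤ ∫ s, (2 * M * q s + 2 * ε ^ 2) ∂μ :=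
        integral_mono_of_nonneg (ae_of_all _ fun s => sq_nonneg _) hrhs (ae_of_all _ hpt)
    _ = 2 * M * ∫ s, q s ∂μ + 2 * ε ^ 2 := by
        rw [integral_add (hq.const_mul _) (integrable_const _), integral_const_mul, integral_const, probReal_univ,
          one_smul]

variable {γ : Measure S} [IsProbabilityMeasure γ]

/-- **The typical-boundary budget from a block entropy budget (abstract form).**  Conditional mean `b = b₀ + Σ_c X_c² + r`
with `Σ_c X_c² ≤ M`, `|r| ≤ ε` on the data law `μ`; each mode `X_c` priced against the reference `γ` with variance proxy
`v_c` (hypotheses of `integral_sq_le_of_klDiv`); then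
`E_μ[(b − b₀)²] ≤ 8M(Σ_c v_c)(KL(μ ‖ γ) + ½) + 2ε²`. [cite: BoucheronLugosiMassart2013, Cor. 4.14] -/
theorem integral_sq_sub_le_of_pricing {ι : Type*} [Fintype ι] (hfin : klDiv μ γ ≠ ⊤) {b r : S → ℝ} {X : ι → S → ℝ}
    {v : ι → ℝ} {b₀ M ε : ℝ}
    (hb : ∀ s, b s = b₀ + (∑ c, X c s ^ 2) + r s) (hM : ∀ s, ∑ c, X c s ^ 2 ≤ M) (hr : ∀ s, |r s| ≤ ε)
    (hv : ∀ c, 0 < v c) (hXμ : ∀ c, Integrable (fun s => X c s ^ 2) μ)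
    (hexp : ∀ c, Integrable (fun s => Real.exp (X c s ^ 2 / (4 * v c))) γ)
    (hmom : ∀ c, ∫ s, Real.exp (X c s ^ 2 / (4 * v c)) ∂γ ≤ Real.exp (1 / 2)) :
    ∫ s, (b s - b₀) ^ 2 ∂μ ≤ 8 * M * (∑ c, v c) * ((klDiv μ γ).toReal + 1 / 2) + 2 * ε ^ 2 := by
  have hq : Integrable (fun s => ∑ c, X c s ^ 2) μ := integrable_finsetSum _ fun c _ => hXμ c
  have hM0 : 0 ≤ M := by
    classical
    by_cases hS : Nonempty S
    · obtain ⟨s⟩ := hS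
      exact (Finset.sum_nonneg fun c _ => sq_nonneg (X c s)).trans (hM s)
    · -- no data: `μ` would not be a probability measure, but the bound is then vacuous anyway
      exact absurd (inferInstance : IsProbabilityMeasure μ) fun h => hS ⟨(nonempty_of_isProbabilityMeasure μ).some⟩
  have step1 := integral_sq_sub_le_of_decomp (μ := μ) hb (fun s => Finset.sum_nonneg fun c _ => sq_nonneg (X c s)) hM hr hq
  have step2 := integral_sum_sq_le_of_klDiv (ν := μ) (γ := γ) hfin hv hXμ hexp hmom
  have h2M : 0 ≤ 2 * M := by linarith
  calc ∫ s, (b s - b₀) ^ 2 ∂μ ≤ 2 * M * ∫ s, ∑ c, X c s ^ 2 ∂μ + 2 * ε ^ 2 := step1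
    _ ≤ 2 * M * (4 * (∑ c, v c) * ((klDiv μ γ).toReal + 1 / 2)) + 2 * ε ^ 2 := by
        have := mul_le_mul_of_nonneg_left step2 h2M; linarith
    _ = 8 * M * (∑ c, v c) * ((klDiv μ γ).toReal + 1 / 2) + 2 * ε ^ 2 := by ring

/-- **The wall term of the law of total covariance, priced.**  In the setting of `CovTransfer.abs_cov_mixture_sub_le` (pair
moments are `μ`-mixtures of conditional moments `a = E_s[XY]`, `b = E_s[X]`, `c = E_s[Y]`), if BOTH conditional means carry a
priced mean expansion (`b = b₀ + Σ X_c² + r`, `c = c₀ + Σ Y_c² + r'`, ceilings `M`, errors `ε`, variance proxies `v_c`, `w_c`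
with `Σ v_c, Σ w_c ≤ V`), then the mixture covariance differs from the mean conditional covariance by at most
`8MV(KL(μ ‖ γ) + ½) + 2ε²`. [cite: BoucheronLugosiMassart2013, Cor. 4.14] -/
theorem abs_wallTerm_le_of_pricing {ι : Type*} [Fintype ι] (hfin : klDiv μ γ ≠ ⊤) {mXY mX mY : ℝ} {a b c r r' : S → ℝ}
    {X Y : ι → S → ℝ} {v w : ι → ℝ} {b₀ c₀ M ε V : ℝ}
    (ha : Integrable a μ) (hbL2 : MemLp b 2 μ) (hcL2 : MemLp c 2 μ)
    (hXY : mXY = ∫ s, a s ∂μ) (hXm : mX = ∫ s, b s ∂μ) (hYm : mY = ∫ s, c s ∂μ)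
    (hb : ∀ s, b s = b₀ + (∑ i, X i s ^ 2) + r s) (hMb : ∀ s, ∑ i, X i s ^ 2 ≤ M) (hr : ∀ s, |r s| ≤ ε)
    (hc : ∀ s, c s = c₀ + (∑ i, Y i s ^ 2) + r' s) (hMc : ∀ s, ∑ i, Y i s ^ 2 ≤ M) (hr' : ∀ s, |r' s| ≤ ε)
    (hv : ∀ i, 0 < v i) (hw : ∀ i, 0 < w i) (hvV : ∑ i, v i ≤ V) (hwV : ∑ i, w i ≤ V)
    (hXμ : ∀ i, Integrable (fun s => X i s ^ 2) μ) (hYμ : ∀ i, Integrable (fun s => Y i s ^ 2) μ)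
    (hexpX : ∀ i, Integrable (fun s => Real.exp (X i s ^ 2 / (4 * v i))) γ)
    (hmomX : ∀ i, ∫ s, Real.exp (X i s ^ 2 / (4 * v i)) ∂γ ≤ Real.exp (1 / 2))
    (hexpY : ∀ i, Integrable (fun s => Real.exp (Y i s ^ 2 / (4 * w i))) γ)
    (hmomY : ∀ i, ∫ s, Real.exp (Y i s ^ 2 / (4 * w i)) ∂γ ≤ Real.exp (1 / 2)) :
    |(mXY - mX * mY) - ∫ s, (a s - b s * c s) ∂μ| ≤ 8 * M * V * ((klDiv μ γ).toReal + 1 / 2) + 2 * ε ^ 2 := by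
  have hM0 : 0 ≤ M := by
    obtain ⟨s⟩ : Nonempty S := ⟨(nonempty_of_isProbabilityMeasure μ).some⟩
    exact (Finset.sum_nonneg fun i _ => sq_nonneg (X i s)).trans (hMb s)
  have hK0 : 0 ≤ (klDiv μ γ).toReal + 1 / 2 := by positivity
  set B : ℝ := 8 * M * V * ((klDiv μ γ).toReal + 1 / 2) + 2 * ε ^ 2 with hB
  have hbB : ∫ s, (b s - b₀) ^ 2 ∂μ ≤ B := by
    refine (integral_sq_sub_le_of_pricing hfin hb hMb hr hv hXμ hexpX hmomX).trans ?_
    have : 8 * M * (∑ i, v i) * ((klDiv μ γ).toReal + 1 / 2) ≤ 8 * M * V * ((klDiv μ γ).toReal + 1 / 2) :=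
      mul_le_mul_of_nonneg_right (mul_le_mul_of_nonneg_left hvV (by positivity)) hK0
    linarith
  have hcB : ∫ s, (c s - c₀) ^ 2 ∂μ ≤ B := by
    refine (integral_sq_sub_le_of_pricing hfin hc hMc hr' hw hYμ hexpY hmomY).trans ?_
    have : 8 * M * (∑ i, w i) * ((klDiv μ γ).toReal + 1 / 2) ≤ 8 * M * V * ((klDiv μ γ).toReal + 1 / 2) :=
      mul_le_mul_of_nonneg_right (mul_le_mul_of_nonneg_left hwV (by positivity)) hK0
    linarith
  have hB0 : 0 ≤ B := (integral_nonneg fun s => sq_nonneg _).trans hbB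
  have key := CovTransfer.abs_cov_mixture_sub_le ha hbL2 hcL2 hXY hXm hYm b₀ c₀
  refine key.trans ?_
  calc Real.sqrt (∫ s, (b s - b₀) ^ 2 ∂μ) * Real.sqrt (∫ s, (c s - c₀) ^ 2 ∂μ)
      ≤ Real.sqrt B * Real.sqrt B :=
        mul_le_mul (Real.sqrt_le_sqrt hbB) (Real.sqrt_le_sqrt hcB) (Real.sqrt_nonneg _) (Real.sqrt_nonneg _)
    _ = B := Real.mul_self_sqrt hB0

end WallTerm

end Summit.QuantumFields.YangMills.Theorems.EntropyBudgetEquipartition.ModePricing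

end
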